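import Summits.Ventures.PercRepro.Night2ThreeTwoMissedGlobal

/-!
# PercRepro — the cell `(3, 2)`: the column bound of the missed-point routing at EVERY target (night-2, gen 25)

The column bound `dload S ≤ cap2 S` of the missed-point routing of the big pairs is a tree theorem at the large
targets (`|S ∖ K| ≥ 8`, `Night2ThreeTwoMissedCol`) and for the large flats (`|V| ≥ 11`, `Night2ThreeTwoMissedGlobal`).
This module closes the small cases — targets with `|S ∖ K| ≤ 7` in flats with `8 ≤ |V| ≤ 10` — and assembles the bound
at every target of every flat of the cell:

* `four_le_card_sdiff_of_mem_Uq`: a member's complement in `G` has `≥ 4` points (its complement in `E` spans), so a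
  big member needs `|V| ≥ 8` and its missed-point targets have `|S ∖ K| ≤ |V| − 2`;
* `card_missedSources_le_choose`: the sources of `S` inject into the pairs of `S ∖ K`;
* `not_subset_clF_of_ne`: distinct hyperplanes of members never contain one another (an ANTICHAIN of co-sets);
* `no_triple_of_two_fat`: two fat sources and a source missing three points cannot be pairwise nested — the co-pairs
  `π, π'` and the co-triple `π''` would satisfy `π'' ⊆ π ∪ π'`, `π ⊆ π' ∪ π''`, forcing `π ⊆ π''`;
* `card_fat_sources_le_three`: at most three fat sources (nested for `|V| ≥ 8`);
* **`dload_missed_le_cap2_three_two`**: the column bound at EVERY `S ⊆ G` — by cases on the number `F` of fat sources: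
  `F ≤ 1` (crude: `≤ C(7,2)` sources), `F ≥ 2` with `|V| ≥ 9` or meeting co-pairs (no source missing three points:
  nesting), `|V| = 8` with disjoint co-pairs (`F = 2`, `|S ∖ K| = 6`, `≤ 13` others): `2/20 + 13/198 < 11/60`.
-/

namespace PercRepro.Shadow

open Finset PerFlat ThmH

variable {α : Type*} [DecidableEq α] {M : Matroid α} [M.Finite]

section SmallFacts

variable {G : Finset α}

/-- A member's complement in `G` has at least four points when `|E ∖ G| = 3`: `E ∖ B` spans the rank-`7` matroid. -/
theorem four_le_card_sdiff_of_mem_Uq (hG : G ∈ flatsQ M (5 + 1)) (hd : (gr M \ G).card = 3) {B : Finset α}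
    (hB : B ∈ Uq M (5 + 2) 5) (hBG : B ⊆ G) : 4 ≤ (G \ B).card := by
  have hGg : G ⊆ gr M := (mem_flatsQ.1 hG).1
  have hr : M.eRk ((gr M \ B : Finset α) : Set α) = ((5 + 2 : ℕ) : ℕ∞) := (mem_Uq.1 hB).2.2
  have hr' : rkN M (gr M \ B) = 7 := by rw [eRk_eq_rkN] at hr; exact_mod_cast hr
  have hunion : gr M \ B = (gr M \ G) ∪ (G \ B) := by
    ext a
    simp only [Finset.mem_sdiff, Finset.mem_union]
    constructor
    · intro ⟨ha, haB⟩
      by_cases haG : a ∈ G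
      · exact Or.inr ⟨haG, haB⟩
      · exact Or.inl ⟨ha, haG⟩
    · rintro (⟨ha, haG⟩ | ⟨haG, haB⟩)
      · exact ⟨ha, fun haB => haG (hBG haB)⟩
      · exact ⟨hGg haG, haB⟩
  have hsub := rkN_submod (M := M) (gr M \ G) (G \ B)
  rw [← hunion, hr'] at hsub
  have hD : rkN M (gr M \ G) ≤ 3 := by
    have h := M.eRk_le_encard ((gr M \ G : Finset α) : Set α)
    rw [eRk_eq_rkN, Set.encard_coe_eq_coe_finsetCard, hd] at h
    exact_mod_cast h
  have hc : rkN M (G \ B) ≤ (G \ B).card := by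
    have h := M.eRk_le_encard ((G \ B : Finset α) : Set α)
    rw [eRk_eq_rkN, Set.encard_coe_eq_coe_finsetCard] at h
    exact_mod_cast h
  omega

open scoped Classical in
/-- A source `B` of `S` has `|S ∖ K| ≤ |V| − 2` and forces `|V| ≥ 8`. -/
theorem card_bounds_of_source (hG : G ∈ flatsQ M (5 + 1)) (hd : (gr M \ G).card = 3) {P : Finset α → Prop}
    [DecidablePred P] (hP : ∀ B, P B → 4 ≤ (B \ coloops M G).card) {S B : Finset α}
    (hB : B ∈ missedSources M 5 G P S) :
    (S \ coloops M G).card + 2 ≤ (G \ coloops M G).card ∧ 8 ≤ (G \ coloops M G).card := by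
  have hd' : (gr M \ G).card ≤ 5 := by omega
  obtain ⟨⟨hthin, hPB⟩, hBS, hc2, hsub⟩ := mem_missedSources.1 hB
  have hBU : B ∈ Uq M (5 + 2) 5 := (mem_membersIn.1 (mem_thinMembers.1 hthin).1).1
  have hBG : B ⊆ G := (subset_clF hBU).trans (mem_membersIn.1 (mem_thinMembers.1 hthin).1).2
  have hK : coloops M G ⊆ B := coloops_subset_of_mem_thinMembers hG hd' hthin
  have h4 := four_le_card_sdiff_of_mem_Uq hG hd hBU hBG
  have hSG : S ⊆ G := fun a ha => by
    by_cases haB : a ∈ B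
    · exact hBG haB
    · exact (Finset.mem_sdiff.1 (hsub (Finset.mem_sdiff.2 ⟨ha, haB⟩))).1
  -- `|G ∖ K| = |G ∖ B| + |B ∖ K|` and `|S ∖ K| = |S ∖ B| + |B ∖ K|`
  have e1 : (G \ coloops M G).card = (G \ B).card + (B \ coloops M G).card := by
    rw [← Finset.card_union_of_disjoint]
    · congr 1
      ext a
      simp only [Finset.mem_sdiff, Finset.mem_union]
      constructor
      · intro ⟨haG, haK⟩
        by_cases haB : a ∈ B
        · exact Or.inr ⟨haB, haK⟩
        · exact Or.inl ⟨haG, haB⟩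
      · rintro (⟨haG, haB⟩ | ⟨haB, haK⟩)
        · exact ⟨haG, fun haK => haB (hK haK)⟩
        · exact ⟨hBG haB, haK⟩
    · rw [Finset.disjoint_left]
      intro a ha hb
      exact (Finset.mem_sdiff.1 ha).2 (Finset.mem_sdiff.1 hb).1
  have e2 : (S \ coloops M G).card = (S \ B).card + (B \ coloops M G).card := by
    rw [← Finset.card_union_of_disjoint]
    · congr 1
      ext a
      simp only [Finset.mem_sdiff, Finset.mem_union]
      constructor
      · intro ⟨haS, haK⟩
        by_cases haB : a ∈ B
        · exact Or.inr ⟨haB, haK⟩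
        · exact Or.inl ⟨haS, haB⟩
      · rintro (⟨haS, haB⟩ | ⟨haB, haK⟩)
        · exact ⟨haS, fun haK => haB (hK haK)⟩
        · exact ⟨hBS haB, haK⟩
    · rw [Finset.disjoint_left]
      intro a ha hb
      exact (Finset.mem_sdiff.1 ha).2 (Finset.mem_sdiff.1 hb).1
  have hbig := hP B hPB
  constructor <;> omega

open scoped Classical in
/-- The sources of `S` inject into the pairs of `S ∖ K`. -/
theorem card_missedSources_le_choose (hG : G ∈ flatsQ M (5 + 1)) (hd : (gr M \ G).card ≤ 5)
    {P : Finset α → Prop} [DecidablePred P] (S : Finset α) :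
    (missedSources M 5 G P S).card ≤ (S \ coloops M G).card.choose 2 := by
  rw [← Finset.card_powersetCard]
  have hinj : ∀ B ∈ missedSources M 5 G P S, ∀ B' ∈ missedSources M 5 G P S, S \ B = S \ B' → B = B' := by
    intro B hB B' hB' h
    rw [← Finset.sdiff_sdiff_eq_self (mem_missedSources.1 hB).2.1,
      ← Finset.sdiff_sdiff_eq_self (mem_missedSources.1 hB').2.1, h]
  have himg : (missedSources M 5 G P S).image (fun B => S \ B) ⊆ (S \ coloops M G).powersetCard 2 := by
    intro π hπ
    obtain ⟨B, hB, rfl⟩ := Finset.mem_image.1 hπ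
    have hK : coloops M G ⊆ B := coloops_subset_of_mem_thinMembers hG hd (mem_missedSources.1 hB).1.1
    rw [Finset.mem_powersetCard]
    exact ⟨Finset.sdiff_subset_sdiff (Finset.Subset.refl _) hK, (mem_missedSources.1 hB).2.2.1⟩
  have := Finset.card_le_card himg
  rwa [Finset.card_image_of_injOn (fun B hB B' hB' h => hinj B hB B' hB' h)] at this

/-- Distinct hyperplanes of members never contain one another. -/
theorem not_subset_clF_of_ne {B B' : Finset α} (hB : B ∈ Uq M (5 + 2) 5) (hB' : B' ∈ Uq M (5 + 2) 5)
    (hne : clF M B ≠ clF M B') : ¬ clF M B' ⊆ clF M B := by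
  intro hsub
  apply hne
  symm
  exact flat_eq_of_subset_of_eRk_eq (clF_mem_flatsQ_five_of_mem_Uq hB)
    (by rw [coe_clF]; exact M.isFlat_closure _) hsub
    (by rw [coe_clF, M.eRk_closure_eq]; exact (mem_Uq.1 hB').2.1)

/-- **Two fat hyperplanes and a hyperplane missing three points cannot be pairwise nested**: with the co-sets
`π, π'` (pairs) and `π''` (a triple), `π'' ⊆ π ∪ π'` and `π ⊆ π' ∪ π''` force `π ⊆ π''`, i.e. `cl B'' ⊆ cl B`. -/
theorem no_triple_of_two_fat {B B' B'' : Finset α} (hB : B ∈ Uq M (5 + 2) 5) (hB'' : B'' ∈ Uq M (5 + 2) 5)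
    (hH''G : clF M B'' ⊆ G) (hm : (G \ clF M B).card = 2) (hm' : (G \ clF M B').card = 2)
    (hm'' : (G \ clF M B'').card = 3) (hne : clF M B ≠ clF M B'')
    (h12 : clF M B ∩ clF M B' ⊆ clF M B'')
    (h23 : Disjoint (G \ clF M B) (G \ clF M B') → clF M B' ∩ clF M B'' ⊆ clF M B) : False := by
  apply not_subset_clF_of_ne hB hB'' hne
  -- `G ∖ cl B ⊆ G ∖ cl B''`, hence `cl B'' ⊆ cl B`
  have hcov : ∀ {X Y Z : Finset α}, X ∩ Y ⊆ Z → G \ Z ⊆ (G \ X) ∪ (G \ Y) := by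
    intro X Y Z h a ha
    rw [Finset.mem_sdiff] at ha
    rw [Finset.mem_union, Finset.mem_sdiff, Finset.mem_sdiff]
    by_contra hcon
    push Not at hcon
    exact ha.2 (h (Finset.mem_inter.2 ⟨hcon.1 ha.1, hcon.2 ha.1⟩))
  have c12 := hcov h12
  have hπ : G \ clF M B ⊆ G \ clF M B'' := by
    by_cases hdisj : Disjoint (G \ clF M B) (G \ clF M B')
    · have c23 := hcov (h23 hdisj)
      intro a ha
      rcases Finset.mem_union.1 (c23 ha) with h | h
      · exact absurd (Finset.mem_inter.2 ⟨ha, h⟩) (Finset.disjoint_iff_inter_eq_empty.1 hdisj ▸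
          Finset.notMem_empty a)
      · exact h
    · -- the co-pairs meet: `|π ∪ π'| ≤ 3 = |π''|` and `π'' ⊆ π ∪ π'`, so `π'' = π ∪ π' ⊇ π`
      have hui := Finset.card_union_add_card_inter (G \ clF M B) (G \ clF M B')
      have hpos : 0 < ((G \ clF M B) ∩ (G \ clF M B')).card := by
        rw [Finset.card_pos, Finset.nonempty_iff_ne_empty]
        intro h
        exact hdisj (Finset.disjoint_iff_inter_eq_empty.2 h)
      have heq : G \ clF M B'' = (G \ clF M B) ∪ (G \ clF M B') :=
        Finset.eq_of_subset_of_card_le c12 (by omega)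
      rw [heq]
      exact Finset.subset_union_left
  intro a ha
  by_contra haB
  have : a ∈ G \ clF M B := Finset.mem_sdiff.2 ⟨hH''G ha, haB⟩
  exact (Finset.mem_sdiff.1 (hπ this)).2 ha

end SmallFacts

section SmallColumn

variable {G : Finset α}

open scoped Classical in
/-- At most three fat sources at any target (`|V| ≥ 8`: the fat hyperplanes are nested). -/
theorem card_fat_sources_le_three (hG : G ∈ flatsQ M (5 + 1)) (hd : (gr M \ G).card ≤ 5) (hk : kColoops M G = 2)
    (hs : ∀ e ∈ gr M, ∀ f ∈ gr M, e ≠ f → rkN M {e, f} = 2) (h8 : 8 ≤ (G \ coloops M G).card)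
    {P : Finset α → Prop} [DecidablePred P] (S : Finset α) :
    ((missedSources M 5 G P S).filter (fun B => (G \ clF M B).card = 2)).card ≤ 3 := by
  rw [card_sources_le_card_image_clF]
  apply card_le_three_of_inter_subset (S := G)
  · intro H hH
    obtain ⟨B', hB', rfl⟩ := Finset.mem_image.1 hH
    exact (mem_membersIn.1 (mem_thinMembers.1 (mem_missedSources.1 (Finset.mem_filter.1 hB').1).1.1).1).2
  · intro H hH
    obtain ⟨B', hB', rfl⟩ := Finset.mem_image.1 hH
    exact (Finset.mem_filter.1 hB').2
  · intro H hH H' hH' H'' hH'' hne _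
    obtain ⟨B₁, hB₁, rfl⟩ := Finset.mem_image.1 hH
    obtain ⟨B₂, hB₂, rfl⟩ := Finset.mem_image.1 hH'
    obtain ⟨B₃, hB₃, rfl⟩ := Finset.mem_image.1 hH''
    refine inter_clF_subset_of_three hG hd hk hs
      (mem_missedSources.1 (Finset.mem_filter.1 hB₁).1).1.1
      (mem_missedSources.1 (Finset.mem_filter.1 hB₂).1).1.1
      (mem_missedSources.1 (Finset.mem_filter.1 hB₃).1).1.1 ?_ hne
    have := Finset.card_union_le (G \ clF M B₁) (G \ clF M B₂)
    rw [(Finset.mem_filter.1 hB₁).2, (Finset.mem_filter.1 hB₂).2] at this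
    rw [(Finset.mem_filter.1 hB₃).2]
    omega

open scoped Classical in
/-- With two fat sources whose co-pairs are small against `V` (`|π ∪ π'| + 5 ≤ |V|`), no source misses exactly three
points. -/
theorem no_three_source_of_two_fat (hG : G ∈ flatsQ M (5 + 1)) (hd : (gr M \ G).card ≤ 5) (hk : kColoops M G = 2)
    (hs : ∀ e ∈ gr M, ∀ f ∈ gr M, e ≠ f → rkN M {e, f} = 2) {P : Finset α → Prop} [DecidablePred P] {S : Finset α}
    {B₁ B₂ : Finset α} (hB₁ : B₁ ∈ missedSources M 5 G P S) (hB₂ : B₂ ∈ missedSources M 5 G P S)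
    (hm₁ : (G \ clF M B₁).card = 2) (hm₂ : (G \ clF M B₂).card = 2) (hne : B₁ ≠ B₂)
    (hsum : ((G \ clF M B₁) ∪ (G \ clF M B₂)).card + 5 ≤ (G \ coloops M G).card) :
    ((missedSources M 5 G P S).filter (fun B => (G \ clF M B).card = 3)).card = 0 := by
  rw [Finset.card_eq_zero, Finset.filter_eq_empty_iff]
  intro B₃ hB₃ hm₃
  have hthin₁ := (mem_missedSources.1 hB₁).1.1
  have hthin₂ := (mem_missedSources.1 hB₂).1.1
  have hthin₃ := (mem_missedSources.1 hB₃).1.1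
  have hU₁ : B₁ ∈ Uq M (5 + 2) 5 := (mem_membersIn.1 (mem_thinMembers.1 hthin₁).1).1
  have hU₂ : B₂ ∈ Uq M (5 + 2) 5 := (mem_membersIn.1 (mem_thinMembers.1 hthin₂).1).1
  have hU₃ : B₃ ∈ Uq M (5 + 2) 5 := (mem_membersIn.1 (mem_thinMembers.1 hthin₃).1).1
  have hHG₃ : clF M B₃ ⊆ G := (mem_membersIn.1 (mem_thinMembers.1 hthin₃).1).2
  -- distinct hyperplanes (sources are traces of their hyperplanes)
  have hne12 : clF M B₁ ≠ clF M B₂ := fun h => hne (by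
    rw [source_eq_inter_clF hB₁, source_eq_inter_clF hB₂, h])
  have hne13 : clF M B₁ ≠ clF M B₃ := fun h => by
    have : B₁ = B₃ := by rw [source_eq_inter_clF hB₁, source_eq_inter_clF hB₃, h]
    rw [this] at hm₁; omega
  have hne23 : clF M B₂ ≠ clF M B₃ := fun h => by
    have : B₂ = B₃ := by rw [source_eq_inter_clF hB₂, source_eq_inter_clF hB₃, h]
    rw [this] at hm₂; omega
  -- the nestings `H₁ ∩ H₂ ⊆ H₃` and `H₂ ∩ H₃ ⊆ H₁`
  have h12 : clF M B₁ ∩ clF M B₂ ⊆ clF M B₃ :=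
    inter_clF_subset_of_three hG hd hk hs hthin₁ hthin₂ hthin₃ (by omega) hne12
  have h23 : Disjoint (G \ clF M B₁) (G \ clF M B₂) → clF M B₂ ∩ clF M B₃ ⊆ clF M B₁ := by
    intro hdisj
    refine inter_clF_subset_of_three hG hd hk hs hthin₂ hthin₃ hthin₁ ?_ hne23
    have h1 := Finset.card_union_le (G \ clF M B₂) (G \ clF M B₃)
    have h2 := Finset.card_union_of_disjoint hdisj
    omega
  exact no_triple_of_two_fat hU₁ hU₃ hHG₃ hm₁ hm₂ hm₃ hne13 h12 h23

open scoped Classical in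
/-- Two fat sources with DISJOINT co-pairs are the only fat sources (`|V| ≥ 8`): a third fat hyperplane would be
nested with them, and `π₁ ⊆ π₂ ∪ π₃` with `π₁ ∩ π₂ = ∅` forces `π₁ = π₃`. -/
theorem card_fat_sources_le_two_of_disjoint (hG : G ∈ flatsQ M (5 + 1)) (hd : (gr M \ G).card ≤ 5)
    (hk : kColoops M G = 2) (hs : ∀ e ∈ gr M, ∀ f ∈ gr M, e ≠ f → rkN M {e, f} = 2)
    (h8 : 8 ≤ (G \ coloops M G).card) {P : Finset α → Prop} [DecidablePred P] {S : Finset α}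
    {B₁ B₂ : Finset α} (hB₁ : B₁ ∈ missedSources M 5 G P S) (hB₂ : B₂ ∈ missedSources M 5 G P S)
    (hm₁ : (G \ clF M B₁).card = 2) (hm₂ : (G \ clF M B₂).card = 2)
    (hdisj : Disjoint (G \ clF M B₁) (G \ clF M B₂)) :
    ((missedSources M 5 G P S).filter (fun B => (G \ clF M B).card = 2)).card ≤ 2 := by
  have hsub : (missedSources M 5 G P S).filter (fun B => (G \ clF M B).card = 2) ⊆ {B₁, B₂} := by
    intro B₃ hB₃'
    rw [Finset.mem_filter] at hB₃'
    obtain ⟨hB₃, hm₃⟩ := hB₃'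
    rw [Finset.mem_insert, Finset.mem_singleton]
    by_contra hcon
    push Not at hcon
    have hthin₁ := (mem_missedSources.1 hB₁).1.1
    have hthin₂ := (mem_missedSources.1 hB₂).1.1
    have hthin₃ := (mem_missedSources.1 hB₃).1.1
    have hHG₁ : clF M B₁ ⊆ G := (mem_membersIn.1 (mem_thinMembers.1 hthin₁).1).2
    have hHG₃ : clF M B₃ ⊆ G := (mem_membersIn.1 (mem_thinMembers.1 hthin₃).1).2
    have hne23 : clF M B₂ ≠ clF M B₃ := fun h =>
      hcon.2 (by rw [source_eq_inter_clF hB₃, source_eq_inter_clF hB₂, h])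
    -- `H₂ ∩ H₃ ⊆ H₁`
    have h23 : clF M B₂ ∩ clF M B₃ ⊆ clF M B₁ := by
      refine inter_clF_subset_of_three hG hd hk hs hthin₂ hthin₃ hthin₁ ?_ hne23
      have := Finset.card_union_le (G \ clF M B₂) (G \ clF M B₃)
      omega
    -- hence `π₁ ⊆ π₂ ∪ π₃`, and by disjointness `π₁ ⊆ π₃`, so `π₁ = π₃` and `B₁ = B₃`
    have hπ : G \ clF M B₁ ⊆ G \ clF M B₃ := by
      intro a ha
      rw [Finset.mem_sdiff] at ha
      rw [Finset.mem_sdiff]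
      refine ⟨ha.1, fun haB₃ => ?_⟩
      have haB₂ : a ∈ clF M B₂ := by
        by_contra haB₂
        exact Finset.disjoint_left.1 hdisj (Finset.mem_sdiff.2 ha) (Finset.mem_sdiff.2 ⟨ha.1, haB₂⟩)
      exact ha.2 (h23 (Finset.mem_inter.2 ⟨haB₂, haB₃⟩))
    have heq : G \ clF M B₁ = G \ clF M B₃ := Finset.eq_of_subset_of_card_le hπ (by omega)
    have hH : clF M B₁ = clF M B₃ := by
      rw [← Finset.sdiff_sdiff_eq_self hHG₁, ← Finset.sdiff_sdiff_eq_self hHG₃, heq]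
    exact hcon.1 (by rw [source_eq_inter_clF hB₁, source_eq_inter_clF hB₃, hH])
  exact (Finset.card_le_card hsub).trans (Finset.card_le_two)

open scoped Classical in
/-- **THE COLUMN BOUND OF THE MISSED-POINT ROUTING AT EVERY TARGET** (cell `(3, 2)`): for every `S ⊆ G`,
`dload S ≤ cap2 S` for the big members (`|B ∖ K| ≥ 4`) routed by `dshMissed`. -/
theorem dload_missed_le_cap2_three_two (hG : G ∈ flatsQ M (5 + 1)) (hd : (gr M \ G).card = 3)
    (hk : kColoops M G = 2) (hs : ∀ e ∈ gr M, ∀ f ∈ gr M, e ≠ f → rkN M {e, f} = 2)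
    (hl : ∀ e ∈ gr M, M.Indep {e}) {P : Finset α → Prop} [DecidablePred P]
    (hP : ∀ B, P B → 4 ≤ (B \ coloops M G).card) (S : Finset α) :
    dload M 5 G P (dshMissed M 5 G) S ≤ cap2 M 5 G S := by
  have hd' : (gr M \ G).card ≤ 5 := by omega
  by_cases hne : (missedSources M 5 G P S).Nonempty
  swap
  · rw [Finset.not_nonempty_iff_eq_empty] at hne
    have hw := dload_missed_le_weighted hG hd hk hs hl hP S
    rw [hne, Finset.filter_empty, Finset.filter_empty, Finset.card_empty] at hw
    have := cap2_nonneg (capS_nonneg' hG hd' S)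
    push_cast at hw
    linarith
  obtain ⟨B, hB⟩ := hne
  obtain ⟨hS2, h8⟩ := card_bounds_of_source hG hd hP hB
  -- the large targets
  by_cases h8S : 8 ≤ (S \ coloops M G).card
  · exact dload_missed_le_cap2_of_eight_le hG hd hk hs hl hP h8S
  push Not at h8S
  -- the capacity
  have hcap : (11 / 60 : ℚ) ≤ cap2 M 5 G S := by
    obtain ⟨⟨hthin, hPB⟩, hBS, hc2, hsub⟩ := mem_missedSources.1 hB
    obtain ⟨z, x, hzx, hzx'⟩ := Finset.card_eq_two.1 hc2
    have hz : z ∈ G \ clF M B := hsub (by rw [hzx']; exact Finset.mem_insert_self _ _)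
    have hx : x ∈ G \ clF M B := hsub (by rw [hzx']; exact Finset.mem_insert_of_mem (Finset.mem_singleton_self _))
    have hSeq : S = insert x (insert z B) := by
      ext a
      constructor
      · intro ha
        by_cases haB : a ∈ B
        · exact Finset.mem_insert_of_mem (Finset.mem_insert_of_mem haB)
        · have : a ∈ S \ B := Finset.mem_sdiff.2 ⟨ha, haB⟩
          rw [hzx', Finset.mem_insert, Finset.mem_singleton] at this
          rcases this with rfl | rfl
          · exact Finset.mem_insert_of_mem (Finset.mem_insert_self _ _)
          · exact Finset.mem_insert_self _ _
      · intro ha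
        rw [Finset.mem_insert, Finset.mem_insert] at ha
        rcases ha with rfl | rfl | haB
        · exact (Finset.mem_sdiff.1 (by rw [hzx']; exact Finset.mem_insert_of_mem (Finset.mem_singleton_self _) :
            a ∈ S \ B)).1
        · exact (Finset.mem_sdiff.1 (by rw [hzx']; exact Finset.mem_insert_self _ _ : a ∈ S \ B)).1
        · exact hBS haB
    rw [hSeq]
    exact cap2_ge_of_missed_three_two hG hd hk hs hthin (hP B hPB) hz hx hzx
  have hw := dload_missed_le_weighted hG hd hk hs hl hP S
  set F := (missedSources M 5 G P S).filter (fun B => (G \ clF M B).card = 2) with hF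
  set R := (missedSources M 5 G P S).filter (fun B => (G \ clF M B).card = 3) with hR
  have hF3 : F.card ≤ 3 := card_fat_sources_le_three hG hd' hk hs h8 S
  -- `F` and `R` are disjoint subfamilies of the sources
  have hFR : F.card + R.card ≤ (S \ coloops M G).card.choose 2 := by
    have hdisj : Disjoint F R := by
      rw [Finset.disjoint_left]
      intro B hBF hBR
      rw [hF, Finset.mem_filter] at hBF
      rw [hR, Finset.mem_filter] at hBR
      omega
    have hsub : F ∪ R ⊆ missedSources M 5 G P S :=
      Finset.union_subset (Finset.filter_subset _ _) (Finset.filter_subset _ _)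
    have := Finset.card_le_card hsub
    rw [Finset.card_union_of_disjoint hdisj] at this
    exact this.trans (card_missedSources_le_choose hG hd' S)
  have hch : (S \ coloops M G).card.choose 2 ≤ 21 :=
    (Nat.choose_le_choose 2 (show (S \ coloops M G).card ≤ 7 by omega)).trans (by decide)
  have hF' : (F.card : ℚ) ≤ 3 := by exact_mod_cast hF3
  rcases Nat.lt_or_ge F.card 2 with hF1 | hF2
  · -- at most one fat source: at most `21` sources in all
    have hR' : (R.card : ℚ) ≤ 21 := by exact_mod_cast (by omega : R.card ≤ 21)
    have hF1' : (F.card : ℚ) ≤ 1 := by exact_mod_cast (by omega : F.card ≤ 1)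
    linarith
  · obtain ⟨B₁, hB₁, B₂, hB₂, hne12⟩ := Finset.one_lt_card.1 hF2
    rw [hF, Finset.mem_filter] at hB₁ hB₂
    by_cases hsum : ((G \ clF M B₁) ∪ (G \ clF M B₂)).card + 5 ≤ (G \ coloops M G).card
    · -- no source misses exactly three points
      have hR0 : R.card = 0 := no_three_source_of_two_fat hG hd' hk hs hB₁.1 hB₂.1 hB₁.2 hB₂.2 hne12 hsum
      rw [hR0] at hw
      push_cast at hw
      linarith
    · -- `|V| = 8`, disjoint co-pairs, `|S ∖ K| = 6`: two fat sources and at most `13` others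
      push Not at hsum
      have hu := Finset.card_union_add_card_inter (G \ clF M B₁) (G \ clF M B₂)
      rw [hB₁.2, hB₂.2] at hu
      have hdisj : Disjoint (G \ clF M B₁) (G \ clF M B₂) := by
        rw [Finset.disjoint_iff_inter_eq_empty, ← Finset.card_eq_zero]
        omega
      have hF2' : F.card ≤ 2 :=
        card_fat_sources_le_two_of_disjoint hG hd' hk hs h8 hB₁.1 hB₂.1 hB₁.2 hB₂.2 hdisj
      have hS6 : (S \ coloops M G).card ≤ 6 := by omega
      have hch6 : (S \ coloops M G).card.choose 2 ≤ 15 :=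
        (Nat.choose_le_choose 2 hS6).trans (by decide)
      have hR' : (R.card : ℚ) ≤ 13 := by exact_mod_cast (by omega : R.card ≤ 13)
      have hF2'' : (F.card : ℚ) ≤ 2 := by exact_mod_cast hF2'
      linarith

end SmallColumn

end PercRepro.Shadow
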